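import Summits.ResolutionOfSingularities.ResolutionOfSingularities.Theorems.HilbertSamuelEliminationSigmaMaxModificationsCorridor3WLadderStrataDepthRuled
import HarnessLib

/-!
# [OURS · L1 W4.2] `Corridor3WLadderStrataDepthRuledComponent` — ROW-J support, irreducibility-free form: over a centre of positive
# dimension at `x_n`, a depth jump puts a whole irreducible COMPONENT of the fibre `f⁻¹(x_n)` through `x_{n+1}` inside the jumping
# component `Z'` (hence inside `X_{n+1}(ν)`)

Sibling of `…Corridor3WLadderStrataDepthRuled` §3 (object (DG) ROW-J SUPPORT, res-L1-w42-plan-1 RULING v3.14-13a; seat res-type-053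
gen 10): there the conclusion `f⁻¹(x_n) ⊆ Z'` needed the fibre to be irreducible (the `ℙ¹ = ℙ(Dir_{x_n}/T_{x_n}D)` of the W-top
dictionary). Without that input the same argument gives: **the generisation `z'` of `x_{n+1}` inside `Z' ∩ f⁻¹(x_n)` is a MAXIMAL point
of the fibre** (the fibre has codimension `≤ 1` at `x_{n+1}`, LIB `IsBlowup.coheight_preimage_le_of_isPermissibleAt`), so the
irreducible component `cl z'` of `f⁻¹(x_n)` through `x_{n+1}` lies in `Z'`. OURS (cell res-hironaka, slot W4.2); NOT statements of
H. Hironaka's manuscript [Hironaka2017] nor of [CossartJannsenSaito2020]; AI-proved, weaker than expert review. Sorry-free PROOF file (no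
definition, no named fact, no binder; per step). `--supports stmt-ResolutionOfSingularities-19249 --as helper`.
-/

noncomputable section

set_option linter.dupNamespace false

open CategoryTheory AlgebraicGeometry TopologicalSpace Topology Order IsLocalRing
open Summit.ResolutionOfSingularities.ResolutionOfSingularities.Theorems.CampaignW42
open Literature.AlgebraicGeometry.Resolution Literature.RingTheory.HilbertSamuel
open Summit.ResolutionOfSingularities.ResolutionOfSingularities.Theorems.SigmaMaxModificationsCorridor3
open Scheme.IdealSheafData

namespace Summit.ResolutionOfSingularities.ResolutionOfSingularities.Theorems.SigmaMaxModificationsCorridor3.Moving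

universe u

variable {R : ∀ S : Scheme.{u}, CentreSeq S → Prop} {ν : ℕ → ℕ}

/-- **A DEPTH JUMP OVER A POSITIVE-DIMENSIONAL CENTRE PUTS A COMPONENT OF THE FIBRE INSIDE `Z'`.** One canonical near step
`s → s'` at level `3` under the cycle invariant (admissible functional oracle, `ν ≠ Φ^{(3)}`), `x_n` closed, step projection `f`,
canonical centre `C` with `1 ≤ codim_{V(C)}(x_n)`; `Z' ∋ x_{n+1}` irreducible closed with a sandwich at `x_{n+1}` and none at `x_n`
in `cl f(Z')`. Then there is `z'` over `x_n` with `z' ⤳ x_{n+1}`, `z' ≠ x_{n+1}`, MAXIMAL among the points of the fibre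
(`w ⤳ z'`, `f w = x_n` ⇒ `w = z'`), and `cl z' ⊆ Z'`: the irreducible component `cl z'` of `f⁻¹(x_n)` through `x_{n+1}` lies in
`Z'`. [cite: CossartJannsenSaito2020, Thm. 3.10 (proof, p. 46)] [cite: Matsumura1987, Thm. 15.1] -/
theorem exists_fibre_component_subset_of_hasSandwichAt {k : Type u} [Field k] (hRf : OracleFunctional R)
    (hRa : OracleAdmissible R) (hν : ν ≠ iterPSum 3 Phi) {s s' : MarkedStage.{u}} (h : CycleInv k R 3 ν s)
    (hsc : IsClosed ({s.pt} : Set s.W)) {f : s'.W ⟶ s.W} (hf : StepProjection R 3 ν s s' f) {C : s.W.IdealSheafData}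
    {P' : Option (Pending (blowup C))} (hcs : IsCanonicalStep R 3 ν s.L s.P C P') (hxC : s.pt ∈ (C.support : Set s.W))
    (hpos : 1 ≤ coheight (⟨s.pt, hxC⟩ : ↥(C.support : Set s.W))) {Z' : Set s'.W} (hirr : IsIrreducible Z') (hcl : IsClosed Z')
    (hx' : s'.pt ∈ Z') (hup : HasSandwichAt s' Z') (hdown : ¬ HasSandwichAt s (closure (f.base '' Z'))) :
    ∃ z' : s'.W, f.base z' = s.pt ∧ z' ⤳ s'.pt ∧ z' ≠ s'.pt ∧ (∀ w : s'.W, f.base w = s.pt → w ⤳ z' → w = z') ∧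
      closure ({z'} : Set s'.W) ⊆ Z' := by
  haveI := s.ln
  haveI := s'.ln
  obtain ⟨C₀, P₀, hcs₀, hbl⟩ := hf.exists_isCanonicalStep_and_isBlowup
  obtain rfl : C = C₀ := hcs.centre_unique hRf hcs₀
  obtain ⟨-, -, hpermC, -⟩ := h.centre hRa hν hcs
  have hfx : f.base s'.pt = s.pt := hf.base_pt
  obtain ⟨z', hz'Z, hzx, hne, hfz⟩ := hf.exists_fibre_generization_of_hasSandwichAt hsc hirr hcl hx' hup hdown
  -- the fibre has codimension `≤ 1` at `x'`
  have hyC : f.base s'.pt ∈ (C.support : Set s.W) := by rw [hfx]; exact hxC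
  have hperm : IdealSheafData.IsPermissibleAt C (f.base s'.pt) := hpermC _ hyC
  haveI hregC : IsRegularLocalRing (s.W.presheaf.stalk (f.base s'.pt) ⧸ stalkIdeal C (f.base s'.pt)) := hperm.1
  obtain ⟨d, hd⟩ : ∃ d : ℕ, ringKrullDim (s.W.presheaf.stalk (f.base s'.pt) ⧸ stalkIdeal C (f.base s'.pt)) = d :=
    exists_nat_eq_of_ne_bot_of_ne_top ringKrullDim_ne_bot ringKrullDim_ne_top
  have h1d : 1 ≤ d := by
    have h1 : ((coheight (⟨f.base s'.pt, hyC⟩ : ↥(C.support : Set s.W)) : ℕ∞) : WithBot ℕ∞) ≤ (((d : ℕ) : ℕ∞) : WithBot ℕ∞) := by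
      have h1 := coheight_le_ringKrullDim_quotient_stalkIdeal C hyC
      rw [hd] at h1
      rwa [← WithBot.coe_natCast] at h1
    have e : (⟨s.pt, hxC⟩ : ↥(C.support : Set s.W)) = ⟨f.base s'.pt, hyC⟩ := Subtype.ext hfx.symm
    have h3 : ((1 : ℕ) : ℕ∞) ≤ (d : ℕ∞) := by
      have h4 : (1 : ℕ∞) ≤ (d : ℕ∞) := (e ▸ hpos).trans (WithBot.coe_le_coe.mp h1)
      exact_mod_cast h4
    exact_mod_cast h3
  have hdimX : ringKrullDim (s.W.presheaf.stalk (f.base s'.pt)) ≤ ((d + 1 + 1 : ℕ) : WithBot ℕ∞) := by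
    have hyX : coheight (f.base s'.pt) ≤ (3 : ℕ) := (topologicalKrullDim_le_iff_forall_coheight_le s.W 3).mp h.dim_le _
    rw [AlgebraicGeometry.ringKrullDim_stalk_eq_coheight]
    have h1 : ((coheight (f.base s'.pt) : ℕ∞) : WithBot ℕ∞) ≤ (((3 : ℕ) : ℕ∞) : WithBot ℕ∞) := WithBot.coe_le_coe.mpr hyX
    rw [WithBot.coe_natCast] at h1
    exact h1.trans (by exact_mod_cast (by omega : 3 ≤ d + 1 + 1))
  have hF1 : coheight (⟨s'.pt, rfl⟩ : ↥(f.base ⁻¹' {f.base s'.pt})) ≤ 1 :=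
    hbl.coheight_preimage_le_of_isPermissibleAt s'.pt hperm hd (e := 1) hdimX
  refine ⟨z', hfz, hzx, hne, ?_, closure_minimal (Set.singleton_subset_iff.mpr hz'Z) hcl⟩
  -- maximality of `z'` in the fibre: a further generisation `w` would give a chain `x' < z' < w` of length 2
  intro w hw hwz
  by_contra hwne
  have hzF : z' ∈ f.base ⁻¹' {f.base s'.pt} := by show f.base z' ∈ ({f.base s'.pt} : Set s.W); rw [hfz, hfx]; rfl
  have hwF : w ∈ f.base ⁻¹' {f.base s'.pt} := by show f.base w ∈ ({f.base s'.pt} : Set s.W); rw [hw, hfx]; rfl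
  have hxz : (⟨s'.pt, rfl⟩ : ↥(f.base ⁻¹' {f.base s'.pt})) < ⟨z', hzF⟩ := by
    refine lt_iff_le_not_ge.mpr ⟨Scheme.le_iff_specializes.mpr hzx, fun hle => hne ?_⟩
    exact ((Scheme.le_iff_specializes.mp hle).antisymm hzx).eq.symm
  have hzw : (⟨z', hzF⟩ : ↥(f.base ⁻¹' {f.base s'.pt})) < ⟨w, hwF⟩ := by
    refine lt_iff_le_not_ge.mpr ⟨Scheme.le_iff_specializes.mpr hwz, fun hle => hwne ?_⟩
    exact ((Scheme.le_iff_specializes.mp hle).antisymm hwz).eq.symm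
  have h' := length_le_coheight_head (p := ((RelSeries.singleton _ (⟨s'.pt, rfl⟩ : ↥(f.base ⁻¹' {f.base s'.pt}))).snoc
    ⟨z', hzF⟩ hxz).snoc ⟨w, hwF⟩ (by rw [RelSeries.last_snoc]; exact hzw))
  simp only [RelSeries.snoc_length, RelSeries.singleton_length, zero_add, RelSeries.head_snoc,
    RelSeries.head_singleton] at h'
  have h2 : (2 : ℕ∞) ≤ 1 := (by exact_mod_cast h' : (2 : ℕ∞) ≤ _).trans hF1
  exact absurd h2 (by decide)

end Summit.ResolutionOfSingularities.ResolutionOfSingularities.Theorems.SigmaMaxModificationsCorridor3.Moving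

end
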